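import Summits.MatrixMultiplication.OmegaCensus.STPPThinFamilies
import Summits.MatrixMultiplication.OmegaCensus.STPPSmallPatternT2Below24
import Summits.MatrixMultiplication.OmegaCensus.STPPRepresentationCount

/-!
# ω-census, small pattern `(1,2,2)^k`: the packing law `4k ≤ |H|` in every finite abelian group (from the tree's thin-family filter)

Cell `pub-omega`, ω construction census, seat pub-omega ENG2 (gen 32). HONEST FRAMING (verbatim): lottery ticket; floor =
certified bounds/negative ranges.  Census STRUCTURE bookkeeping (column B5: `T2(H)` = max `k` with `(1,2,2)^k ⊆ H`, CKSU 2005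
Def. 5.1, tree `IsSTPP`); nothing here bears on `ω`.

The explicit bound on record for `T2` is `2k ≤ |H|` (`two_mul_le_card_of_isSTPP_122`, `STPPSmallPatternT2Below24.lean`: the `k`
two-element sets `Bᵢ` are pairwise disjoint).  The pattern `(1,2,2)` is THIN (`|Aᵢ| = 1`), so the tree's tensor-rank filter for
all-thin families, `STPPRank.sum_card_mul_le_card_of_isSTPP_of_thin` (`STPPThinFamilies.lean`, seat stpp-2: `∑ᵢ |Aᵢ||Bᵢ||Cᵢ| ≤ |H|`,
CKSU Thm. 5.5 with each thin block peeled at full volume), gives at once **`4k ≤ |H|`**, i.e. `T2(H) ≤ |H|/4` — recorded here as the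
explicit census-shaped statement (`four_mul_le_card_of_isSTPP_122`, `Nat.card` form, contrapositive).  Companion of
`STPPSmallPatternT1PackingBound.lean` (`3k ≤ |H| + 1` for `(2,1,1)^k`, where the same filter only gives `2k`).  Census data for scale:
`T2(H) ≈ |H|/12` at small orders, onsets `12, 24, 33, 48` vs. this law's `8, 12, 16, 20`.

References: H. Cohn, R. Kleinberg, B. Szegedy, C. Umans, *Group-theoretic algorithms for matrix multiplication*, FOCS 2005
(arXiv:math/0511460), Def. 5.1 and Thm. 5.5.  Seat pub-omega ENG2 (gen 32), 2026-08-28.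
-/

open Literature.Computability.AlgebraicComplexity Finset

namespace Summit.MatrixMultiplication.OmegaCensus

variable {H : Type*} [AddCommGroup H]

/-- **Packing law for `(1,2,2)^k`: `4k ≤ |H|`** in every finite abelian group `H` hosting `(1,2,2)^k` (the tree's thin-family
tensor-rank filter, each block of volume `1·2·2 = 4`). [cite: CohnKleinbergSzegedyUmans2005, Thm. 5.5] -/
theorem four_mul_le_card_of_isSTPP_122 [Fintype H] [DecidableEq H] {k : ℕ}
    (h : ∃ A B C : Fin k → Finset H, IsSTPP A B C ∧ ∀ i, (A i).card = 1 ∧ (B i).card = 2 ∧ (C i).card = 2) :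
    4 * k ≤ Fintype.card H := by
  obtain ⟨A, B, C, hS, hc⟩ := h
  have hne : ∀ i, (A i).Nonempty ∧ (B i).Nonempty ∧ (C i).Nonempty := fun i =>
    ⟨Finset.card_pos.1 (by rw [(hc i).1]; omega), Finset.card_pos.1 (by rw [(hc i).2.1]; omega),
      Finset.card_pos.1 (by rw [(hc i).2.2]; omega)⟩
  have hthin : ∀ i, (A i).card = 1 ∨ (B i).card = 1 ∨ (C i).card = 1 := fun i => Or.inl (hc i).1
  have hsum := STPPRank.sum_card_mul_le_card_of_isSTPP_of_thin A B C hS hne hthin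
  have e : ∑ i, (A i).card * (B i).card * (C i).card = 4 * k := by
    rw [Finset.sum_congr rfl (fun i _ => by rw [(hc i).1, (hc i).2.1, (hc i).2.2]), Finset.sum_const, Finset.card_univ,
      Fintype.card_fin, smul_eq_mul, mul_comm]
  omega

/-- `Nat.card` form of the packing law `4k ≤ |H|` for `(1,2,2)^k`. [cite: CohnKleinbergSzegedyUmans2005, Thm. 5.5] -/
theorem four_mul_le_natCard_of_isSTPP_122 [Finite H] {k : ℕ}
    (h : ∃ A B C : Fin k → Finset H, IsSTPP A B C ∧ ∀ i, (A i).card = 1 ∧ (B i).card = 2 ∧ (C i).card = 2) :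
    4 * k ≤ Nat.card H := by
  classical
  cases nonempty_fintype H
  rw [Nat.card_eq_fintype_card]; exact four_mul_le_card_of_isSTPP_122 h

/-- Contrapositive: **no finite abelian group of order `< 4k` hosts `(1,2,2)^k`.** [cite: CohnKleinbergSzegedyUmans2005, Thm. 5.5] -/
theorem not_exists_isSTPP_122_of_card_lt_four_mul [Finite H] {k : ℕ} (hH : Nat.card H < 4 * k) :
    ¬ ∃ A B C : Fin k → Finset H, IsSTPP A B C ∧ ∀ i, (A i).card = 1 ∧ (B i).card = 2 ∧ (C i).card = 2 :=
  fun h => absurd (four_mul_le_natCard_of_isSTPP_122 h) (by omega)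

/-!
# APPEND (ENG2 gen 33, 2026-08-28): the tree's filter N9 gives `6k ≤ |H| + 2`

The representation-count filter N9 (`CubeNB.n9`, `STPPRepresentationCount.lean`, seat stpp-1: `Σᵢ|Aᵢ||Bᵢ| + Σᵢ|Bᵢ||Cᵢ| ≤ |H| + |Bⱼ|`)
read on the pattern `(1,2,2)` itself (shared letter the PAIR `Bⱼ`) is **`2k + 4k ≤ |H| + 2`, i.e. `6k ≤ |H| + 2`, `T2(H) ≤ (|H| + 2)/6`**
for every finite abelian `H` — exact at `k = 1` (`ℤ/4`); census onsets `12, 24, 32, 48, 60, 76, 96` vs. this law's `10, 16, 22, 28, 34, 40, 46`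
(the thin-family filter above gives `8, 12, …, 4k`).  Nothing new is proved about STPP here: this is the tree's N9, instantiated so that
column B5 carries the right linear law.
-/

/-- **Packing law for `(1,2,2)^k` from filter N9: `6k ≤ |H| + 2`** in every finite abelian group `H` hosting `(1,2,2)^k`
(`CubeNB.n9`, shared letter `|Bⱼ| = 2`). [cite: CohnKleinbergSzegedyUmans2005, Def. 5.1] -/
theorem six_mul_le_card_add_two_of_isSTPP_122 [Fintype H] [DecidableEq H] {k : ℕ}
    (h : ∃ A B C : Fin k → Finset H, IsSTPP A B C ∧ ∀ i, (A i).card = 1 ∧ (B i).card = 2 ∧ (C i).card = 2) :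
    6 * k ≤ Fintype.card H + 2 := by
  rcases Nat.eq_zero_or_pos k with hk | hk
  · subst hk; simp
  obtain ⟨A, B, C, hS, hc⟩ := h
  have eA : ∀ i, (A i).card = 1 := fun i => (hc i).1
  have eB : ∀ i, (B i).card = 2 := fun i => (hc i).2.1
  have eC : ∀ i, (C i).card = 2 := fun i => (hc i).2.2
  have hA : ∀ i, (A i).Nonempty := fun i => Finset.card_pos.1 (by rw [eA i]; omega)
  have hC : ∀ i, (C i).Nonempty := fun i => Finset.card_pos.1 (by rw [eC i]; omega)
  have h9 := CubeNB.n9 hS hA hC ⟨0, hk⟩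
  simp only [eA, eB, eC, Finset.sum_const, Finset.card_univ, Fintype.card_fin, smul_eq_mul] at h9
  omega

/-- `Nat.card` form of the N9 packing law `6k ≤ |H| + 2` for `(1,2,2)^k`. [cite: CohnKleinbergSzegedyUmans2005, Def. 5.1] -/
theorem six_mul_le_natCard_add_two_of_isSTPP_122 [Finite H] {k : ℕ}
    (h : ∃ A B C : Fin k → Finset H, IsSTPP A B C ∧ ∀ i, (A i).card = 1 ∧ (B i).card = 2 ∧ (C i).card = 2) :
    6 * k ≤ Nat.card H + 2 := by
  classical
  cases nonempty_fintype H
  rw [Nat.card_eq_fintype_card]; exact six_mul_le_card_add_two_of_isSTPP_122 h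

/-- Contrapositive: **no finite abelian group of order `< 6k − 2` hosts `(1,2,2)^k`.** [cite: CohnKleinbergSzegedyUmans2005, Def. 5.1] -/
theorem not_exists_isSTPP_122_of_card_add_two_lt [Finite H] {k : ℕ} (hH : Nat.card H + 2 < 6 * k) :
    ¬ ∃ A B C : Fin k → Finset H, IsSTPP A B C ∧ ∀ i, (A i).card = 1 ∧ (B i).card = 2 ∧ (C i).card = 2 :=
  fun h => absurd (six_mul_le_natCard_add_two_of_isSTPP_122 h) (by omega)

end Summit.MatrixMultiplication.OmegaCensus
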